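import Summits.BirchSwinnertonDyer.BirchSwinnertonDyer.Theorems.GenusKolyvaginAtTwoMinimalTwinBSDTwoSwappedPairDescent
import HarnessLib

/-!
# Route `GenusKolyvaginAtTwo`, crux U₂ `MinimalTwinBSDTwo` (stmt-BirchSwinnertonDyer-22985), LINE 23 «twin_swap» v1.2:
# THE `2`-PRIMITIVITY CLAUSE OF STUB S2′ IS LOSSLESS — inside the genus budget, `BSD₂(E) ∧ BSD₂(E^(d_K))` FORCE `y_K ∉ 2E(K[1])`

Seat `bsd-line-gk2-p2` g23 (PROVER seat 2/3, cell `bsd-f1-sign2`), `--supports stmt-BirchSwinnertonDyer-22985` (helper; closes nothing).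
THEOREMS ONLY (no definition, no named fact, no `sorry`).  **BSD is NOT proved by this file; U₂ / hTw is NOT proved; no item is closed.**
Every theorem is CONDITIONAL on the conclusion the line wants (`BSD₂` of the rank-one curve) and on the route's four print items
(GZ 24148, GZK 19921, entire-L 19273, Milne any-model 24149): it is the CONVERSE direction of the sequel file's S3′
(`swappedPairDescentAtTwo_depthZero_of_facts`), i.e. a NO-OVER-CLAIM certificate for the reshaped supply stub S2′ of LINE 23 v1.2
(LEAD word 2026-08-30T07:17Z) — mirroring gk2-p5 g34's `GenusSupplyNarrow.Lossless` for the supply cruxes' depth-zero kernels.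

WHAT IS PROVED.  `not_exists_two_smul_derivedPoint_of_bsdp_of_facts`: `GZ → GZK → modularity → Milne →` for `W/ℚ` globally minimal with
`r_an(E) = 1`, `#Sel₂(E) = 2`, `C(E)` odd; `K` imaginary quadratic, `d_K` odd `≠ −3`, Heegner; a datum `Dt` with `Dt.c` odd, `(β, ι)`, a
conductor-`1` datum `d₁` with `P(1)` of infinite order; a globally minimal `2`-Selmer-trivial twin `Wd ≅ E^(d_K)` inside the genus budget
`(Δ_E < 0 ∧ ord₂ C(Wd) ≤ 1) ∨ ord₂ C(Wd) = 0`; and **`BSD₂(Wd) ∧ BSD₂(E)`**: then **`P(1) ∉ 2E(K[1])`**.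
Mechanism: Milne any-model + GZK turn `BSD₂(E) ∧ BSD₂(Wd)` into `MissingPPartOverCAt (W ⊗ K) 2` (tree `missingPPartOverCAt_baseChange_iff_bsdp`);
Gross–Zagier V.§2 over `K` reads `#Ш_an(E_K) = 4I²/(c²·w_K²·C(E)²)` (`CMExactDescent.shaAnOverC_baseChange_eq_of_heegner`) of `2`-adic valuation
`2·ord₂ I`; the swapped pair sandwich (`natCard_primaryComponent_sha_baseChange_two_eq_one_of_swappedPair`, UNCONDITIONAL) gives
`ord₂ #Ш(E_K) = 0`; so `ord₂[E(K):ℤP₀] = 0`, i.e. `P₀ ∉ 2E(K)` (McCallum 5.1 bookkeeping `padicValNat_index_zmultiples_eq_of_divisibility`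
at the exact exponent of `P₀`), i.e. `P(1) ∉ 2E(K[1])` (`E(K[1])[2] = 0`).  NET for the line: with S3′ (⟸) and this file (⟹), on the budget
slice **«`y_K` is `2`-primitive» ⟺ «BSD₂ transfers from the twin to `E`»** modulo PRINT — S2′ carries no slack.  Beyond print: no.

References: [GrossZagier1986] V.§2; [GrossLMS1991] §2 (2.2), §4 (4.1); [McCallumLMS1991] §5 Lemma 5.1; [Milne1972ArithmeticAV] §1 Thm. 1;
[Kramer1981] Thm. 1; [Miller2011LMS] Def. 1.1.
-/

set_option autoImplicit false
set_option linter.dupNamespace false -- `Summit.<P>.<Sub>` repeats `BirchSwinnertonDyer` (D-0017)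

noncomputable section

open scoped Classical

open WeierstrassCurve NumberField Literature.NumberTheory.EllipticCurves
  Literature.NumberTheory.EllipticCurves.ModularForms
  Literature.NumberTheory.EllipticCurves.Rank1Residual
  Literature.NumberTheory.EllipticCurves.Rank1Residual.Typed
  Literature.NumberTheory.EllipticCurves.KrizLi2019
  Summit.BirchSwinnertonDyer.Rank1Residual
  Summit.BirchSwinnertonDyer.Rank1Residual.AdditivePotMult
  Summit.BirchSwinnertonDyer.BirchSwinnertonDyer.Theorems.CMExactDescent

namespace Summit.BirchSwinnertonDyer.BirchSwinnertonDyer.Theorems.GenusExact.TwinSwap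

/-- **THE `2`-PRIMITIVITY CLAUSE OF S2′ IS NECESSARY (modulo PRINT and the target).**  On LINE 23's budget slice (binders of
`swappedPairDescentAtTwo_depthZero_of_facts` minus the primitivity clause), `BSD₂(Wd) ∧ BSD₂(E)` imply **`P(1) ∉ 2E(K[1])`**:
Milne + GZK ⟹ `MissingPPartOverCAt (W ⊗ K) 2`; Gross–Zagier over `K` ⟹ `ord₂ #Ш_an(E_K) = 2·ord₂[E(K):ℤP₀]` (`w_K = 2`, `c`, `C(E)` odd);
the swapped pair sandwich ⟹ `ord₂ #Ш(E_K) = 0`; hence `[E(K):ℤP₀]` is odd and `P₀ ∉ 2E(K)`, `P(1) ∉ 2E(K[1])`.  CONDITIONAL on the four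
named facts; credits nothing by itself.  [cite: GrossZagier1986, V.§2 (pp. 310–312)] [cite: Milne1972ArithmeticAV, §1 Thm. 1]
[cite: McCallumLMS1991, §5 Lemma 5.1] [cite: Kramer1981, Thm. 1] [cite: Miller2011LMS, Def. 1.1] -/
theorem not_exists_two_smul_derivedPoint_of_bsdp_of_facts
    (hGZ : ∀ (N : ℕ) [NeZero N] (W : WeierstrassCurve ℚ) (K : Type) [Field K] [NumberField K],
      gross_zagier N W K)
    (hGZK : rank_eq_analyticRank_of_analyticRank_le_one) (hmod : hasEntireLFunction_rat)
    (hMilneC : Milne1972.bsdQuotient_baseChange_quadratic_anyModel) :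
    ∀ (W : WeierstrassCurve ℚ) [W.IsElliptic] [W.IsGloballyMinimal] [NeZero (W.conductorNorm ℤ)],
      W.analyticRank = 1 → Nat.card (W.selmerGroup 2) = 2 → Odd W.tamagawaProduct →
      ∀ (K : Type) [Field K] [NumberField K], IsImaginaryQuadratic K → Odd (NumberField.discr K) →
      NumberField.discr K ≠ -3 → SatisfiesHeegnerHypothesis (W.conductorNorm ℤ) K →
      ∀ (Dt : ModularParametrizationData W (W.conductorNorm ℤ)), Odd Dt.c →
      ∀ (β : ℤ) (ι : K →+* ℂ) (d₁ : KolyvaginHeegnerData Dt β ι 1), ¬ IsOfFinAddOrder d₁.derivedPoint →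
      ∀ (Wd : WeierstrassCurve ℚ) [Wd.IsElliptic] [Wd.IsGloballyMinimal],
        (∃ C : WeierstrassCurve.VariableChange ℚ, C • W.quadraticTwist (NumberField.discr K : ℚ) = Wd) →
        Nat.card (Wd.selmerGroup 2) = 1 →
        ((W.Δ < 0 ∧ padicValNat 2 Wd.tamagawaProduct ≤ 1) ∨ padicValNat 2 Wd.tamagawaProduct = 0) →
        BSDp Wd 2 → BSDp W 2 →
        ¬ ∃ Q : (W.baseChange (ringClassField K ι 1)).toAffine.Point, (2 : ℤ) • Q = d₁.derivedPoint := by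
  intro W _ _ _ hr hSel hT K _ _ hK hodd h3 hH Dt hc β ι d₁ hy Wd _ _ hWd hSel1 hbudget hBd hBW
  haveI : Fact (Nat.Prime 2) := ⟨Nat.prime_two⟩
  haveI hEK : (W.baseChange K).IsElliptic := isElliptic_baseChange' W K
  have h2 : Module.finrank ℚ K = 2 := hK.1
  have hD0 : (NumberField.discr K : ℚ) ≠ 0 := by exact_mod_cast NumberField.discr_ne_zero K
  haveI hEt : (W.quadraticTwist (NumberField.discr K : ℚ)).IsElliptic := W.isElliptic_quadraticTwist hD0
  obtain ⟨hD4, hDlt⟩ := discr_emod_four_and_lt_of_odd hK hodd h3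
  have hw2 : Units.torsionOrder K = 2 :=
    Literature.NumberTheory.QuadraticFields.Quadratic.torsionOrder_eq_two_of_discr_lt_neg_four h2 hDlt
  have hc0 : Dt.c ≠ 0 := by
    obtain ⟨k, hk⟩ := hc
    omega
  obtain ⟨Cd, hCd⟩ := hWd
  -- the Heegner point `P₀ ∈ E(K)` below `P(1)`
  obtain ⟨P₀, Hd, hP₀, hP₀K⟩ := exists_heegnerPoint_map_eq_derivedPoint_one hK hH d₁
  have hPinf : ¬ IsOfFinAddOrder P₀ := by
    intro hfin
    apply hy
    rw [← hP₀K]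
    exact (WeierstrassCurve.Affine.Point.map (W' := W)
      (algebraMap K (ringClassField K ι 1)).toRatAlgHom).isOfFinAddOrder hfin
  -- ranks over `ℚ`: `rank E(ℚ) ≥ 1`
  haveI : Module.Finite ℤ (W.baseChange K).toAffine.Point := (W.baseChange K).module_finite_point_holds
  have hK1 : 1 ≤ (W.baseChange K).mordellWeilRank :=
    Literature.NumberTheory.EllipticCurves.one_le_mordellWeilRank_of_not_isOfFinAddOrder (W.baseChange K) inferInstance hPinf
  have hSelT : Nat.card ((W.quadraticTwist (NumberField.discr K : ℚ)).selmerGroup ((2 : ℕ) : ℤ)) = 1 := by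
    have h := natCard_selmerGroup_smul (W.quadraticTwist (NumberField.discr K : ℚ)) Cd (n := 2) two_ne_zero
    rw [hCd] at h
    rw [← h, Nat.cast_ofNat]
    exact hSel1
  obtain ⟨hrkT0, -, -⟩ := rank_eq_zero_and_torsionBy_eq_bot_and_sha_inf_torsionBy_eq_bot_of_natCard_selmerGroup_eq_one
    (W.quadraticTwist (NumberField.discr K : ℚ)) 2 hSelT
  have hrk : 1 ≤ W.mordellWeilRank := by
    have hsum := W.mordellWeilRank_baseChange_of_finrank_eq_two_of_finite K h2
    rw [hrkT0, add_zero] at hsum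
    rw [← hsum]
    exact hK1
  -- the swapped pair sandwich: `Ш(E/K)[2^∞] = 0`
  obtain ⟨-, hsha⟩ := natCard_primaryComponent_sha_baseChange_two_eq_one_of_swappedPair W K hT hK hodd hH hrk hSel Cd hCd
    hSel1 hbudget
  -- no `2`-torsion over `K[1]` and over `K`
  obtain ⟨-, hT2, -⟩ := rank_eq_one_and_sha_primary_eq_zero_of_natCard_selmerGroup_eq_two W hSel hrk
  have hT2' : ∀ P : W.toAffine.Point, 2 • P = 0 → P = 0 := fun P hP ↦ by convert hT2 P (by convert hP)
  have htor1 : ∀ (M : ℕ) (R : (W.baseChange (ringClassField K ι 1)).toAffine.Point),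
      ((2 ^ M : ℕ) : ℤ) • R = 0 → R = 0 :=
    fun M R hR ↦ eq_zero_of_two_pow_smul_eq_zero_ringClassField_of_noTwoTorsion W hK hodd hH hT2' ι M R hR
  have hiv : ∀ x : (W.baseChange K).toAffine.Point, 2 • x = 0 → x = 0 := fun x hx ↦
    forall_two_zsmul_baseChange_eq_zero_of_heegner W K hK hodd hH hT2' x (by rw [← natCast_zsmul] at hx; exact_mod_cast hx)
  -- analytic ranks: twin `0`, `E_K` `1`
  have hrt : (W.quadraticTwist (NumberField.discr K : ℚ)).analyticRank = 0 :=
    analyticRank_twist_eq_zero_of_rankOne W K (hGZ _ W K) hmod hK hH hr ⟨Dt, Hd, ι, hP₀⟩ hPinf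
  have hrd : Wd.analyticRank = 0 := by rw [← hCd, analyticRank_smul, hrt]
  have hrK : (W.baseChange K).analyticRank = 1 :=
    (P2.analyticRank_baseChange_eq_one_iff W K hmod h2).mpr (Or.inl ⟨hr, hrt⟩)
  -- Gross–Zagier over `K` in Dokchitser–Dokchitser's currency
  obtain ⟨hrkK, hShaK, -, hshaC⟩ := shaAnOverC_baseChange_eq_of_heegner W K Dt Hd ι P₀ (hGZ _ W K)
    hGZK hmod hK hH hP₀ hc0 hrK
  haveI hfinK : Finite (W.baseChange K).sha := hShaK
  -- `BSD₂(E) ∧ BSD₂(Wd)` ⟹ the `2`-part over `K` (Milne any-model + GZK)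
  have hKin : MissingPPartOverCAt (W.baseChange K) 2 :=
    (missingPPartOverCAt_baseChange_iff_bsdp W 2 K Wd hGZK hmod hMilneC hr.le h2 ⟨Cd, hCd⟩
      (by rw [hrd]; exact zero_le_one) hBd).mpr hBW
  obtain ⟨q, hq, hvq⟩ := hKin
  -- the exact exponent `M` of `P₀` in `E(K)` and `ord₂ [E(K):ℤP₀] = M`
  haveI : Finite (AddCommGroup.torsion (W.baseChange K).toAffine.Point) :=
    WeierstrassCurve.finite_torsion_point (W := W.baseChange K)
  obtain ⟨M, hdivM, hndivM⟩ := exists_pow_smul_eq_and_not_of_not_isOfFinAddOrder Nat.prime_two hPinf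
  obtain ⟨cc, Q, hcQ, hcker⟩ := X11b.RankOne.exists_coord_of_mordellWeilRank_eq_one (W.baseChange K) hrkK
  have hidx : padicValNat 2 (AddSubgroup.zmultiples P₀).index = M :=
    X11b.Three.Koly.padicValNat_index_zmultiples_eq_of_divisibility (p := 2) cc Q hcQ hcker hiv P₀ hdivM hndivM
  -- `ord₂ q = 2 M` (from Gross–Zagier) and `ord₂ q = ord₂ #Ш(E_K) = 0` (from Milne and the sandwich)
  set I := (AddSubgroup.zmultiples P₀).index with hI_def
  have hI0 : I ≠ 0 := fun hI ↦ by
    have hh := P2.torsionOrder_sq_mul_canonicalHeight_eq_index_sq_mul_regulator (W.baseChange K) hrkK P₀ hPinf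
    rw [← hI_def, hI, Nat.cast_zero, zero_pow two_ne_zero, zero_mul, mul_eq_zero, pow_eq_zero_iff two_ne_zero,
      Nat.cast_eq_zero] at hh
    exact hh.elim (W.baseChange K).torsionOrder_pos_holds.ne'
      (fun h0 ↦ hPinf ((Affine.Point.canonicalHeight_eq_zero_iff_holds P₀).mp h0))
  have hq' : q = ((I : ℚ) / ((Dt.c : ℚ) * (W.tamagawaProduct : ℚ))) ^ 2 := by
    have hqq : (q : ℂ) = ((4 * (I : ℚ) ^ 2 /
        ((Dt.c : ℚ) ^ 2 * (Units.torsionOrder K : ℚ) ^ 2 * ((W.tamagawaProduct : ℚ) ^ 2)) : ℚ) : ℂ) := by rw [← hq, hshaC]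
    rw [show q = 4 * (I : ℚ) ^ 2 / ((Dt.c : ℚ) ^ 2 * (Units.torsionOrder K : ℚ) ^ 2 * ((W.tamagawaProduct : ℚ) ^ 2)) by
      exact_mod_cast hqq, hw2]
    push_cast
    field_simp
    ring
  have hcQ0 : (Dt.c : ℚ) ≠ 0 := by exact_mod_cast hc0
  have hcW0 : (W.tamagawaProduct : ℚ) ≠ 0 := by exact_mod_cast W.tamagawaProduct_pos_holds.ne'
  have hIQ0 : (I : ℚ) ≠ 0 := by exact_mod_cast hI0
  have hvc : padicValRat 2 (Dt.c : ℚ) = 0 := by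
    rw [padicValRat.of_int, padicValInt.eq_zero_of_not_dvd (fun h2c ↦
      (Int.not_even_iff_odd.mpr hc) (even_iff_two_dvd.mpr h2c))]
    rfl
  have hvcW : padicValRat 2 (W.tamagawaProduct : ℚ) = 0 := by
    rw [padicValRat.of_nat, padicValNat.eq_zero_of_not_dvd hT.not_two_dvd_nat]
    rfl
  have hval : padicValRat 2 q = 2 * (M : ℤ) := by
    rw [hq', padicValRat.pow, padicValRat.div hIQ0 (mul_ne_zero hcQ0 hcW0),
      padicValRat.mul hcQ0 hcW0, hvc, hvcW, padicValRat.of_nat, hidx]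
    push_cast
    ring
  have hshaV : padicValNat 2 (W.baseChange K).shaOrder = 0 := by
    rw [X11b.Three.Koly.padicValNat_shaOrder_eq (W.baseChange K) 2, hsha]
    simp
  have hM0 : M = 0 := by
    have h : (2 * (M : ℤ)) = 0 := by rw [← hval, hvq, hshaV]; simp
    omega
  subst hM0
  -- `P₀ ∉ 2E(K)`, hence `P(1) ∉ 2E(K[1])`
  intro hprim
  apply hndivM
  refine (X11b.Three.Koly.pDiv_one_iff_exists_zsmul_eq hK d₁ P₀ hP₀K 2 (0 + 1) (htor1 (0 + 1))).mp ?_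
  simpa [X11b.Three.Koly.PDiv] using hprim

/-! ## §2 (append) The instrument dictionary: S2′'s primitivity clause is «odd Heegner index» -/

/-- **THE INSTRUMENT DICTIONARY FOR S2′ (unconditional): `P(1) ∉ 2E(K[1]) ⟺ [E(K) : ℤP₀]` is ODD**, on the swapped frame —
`W/ℚ` globally minimal with `#Sel₂(E) = 2` and `rank E(ℚ) ≥ 1` (so `E(ℚ)[2] = 0`); `K` imaginary quadratic, `d_K` odd, Heegner for
`N_E` (so `E(K)[2] = E(K[1])[2] = 0`); a `2`-Selmer-trivial `ℚ`-model `Wd ≅ E^(d_K)` of the twin (so `rank E(K) = 1`); a conductor-`1`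
datum `d₁` and `P₀ ∈ E(K)` below `P(1)`.  This is the quantity the pen's falsifier REVFALS-g23 computes (`heegner_index` odd on 41/41
odd-Tamagawa rank-one cells, `N ≤ 250`): the run tests EXACTLY the `2`-primitivity clause of stub S2′ (McCallum Lemma 5.1 bookkeeping,
`X11b.Three.Koly.padicValNat_index_zmultiples_eq_of_divisibility`, at the exact `2`-divisibility exponent of `P₀`).  No print fact.
[cite: McCallumLMS1991, §5 Lemma 5.1] [cite: GrossLMS1991, §4 (4.1)] -/
theorem not_exists_two_smul_derivedPoint_iff_odd_index
    (W : WeierstrassCurve ℚ) [W.IsElliptic] [W.IsGloballyMinimal] [NeZero (W.conductorNorm ℤ)]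
    (K : Type) [Field K] [NumberField K]
    (hIQ : IsImaginaryQuadratic K) (hodd : Odd (NumberField.discr K)) (hH : SatisfiesHeegnerHypothesis (W.conductorNorm ℤ) K)
    (hSel : Nat.card (W.selmerGroup 2) = 2) (hrk : 1 ≤ W.mordellWeilRank)
    {Wd : WeierstrassCurve ℚ} [Wd.IsElliptic] (Cd : VariableChange ℚ) (hWd : Cd • W.quadraticTwist (NumberField.discr K : ℚ) = Wd)
    (hSel1 : Nat.card (Wd.selmerGroup 2) = 1)
    {N : ℕ} [NeZero N] {Dt : ModularParametrizationData W N} {β : ℤ} (ι : K →+* ℂ) (d₁ : KolyvaginHeegnerData Dt β ι 1)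
    (P₀ : (W.baseChange K).toAffine.Point)
    (hP₀K : WeierstrassCurve.Affine.Point.map (W' := W) (algebraMap K (ringClassField K ι 1)).toRatAlgHom P₀ = d₁.derivedPoint)
    (hPinf : ¬ IsOfFinAddOrder P₀) :
    (¬ ∃ Q : (W.baseChange (ringClassField K ι 1)).toAffine.Point, (2 : ℤ) • Q = d₁.derivedPoint) ↔
      Odd (AddSubgroup.zmultiples P₀).index := by
  haveI : Fact (Nat.Prime 2) := ⟨Nat.prime_two⟩
  haveI hEK : (W.baseChange K).IsElliptic := isElliptic_baseChange' W K
  have h2 : Module.finrank ℚ K = 2 := hIQ.1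
  have hD0 : (NumberField.discr K : ℚ) ≠ 0 := by exact_mod_cast NumberField.discr_ne_zero K
  haveI hEt : (W.quadraticTwist (NumberField.discr K : ℚ)).IsElliptic := W.isElliptic_quadraticTwist hD0
  -- no `2`-torsion over `K[1]` and over `K`
  obtain ⟨hrkW1, hT2, -⟩ := rank_eq_one_and_sha_primary_eq_zero_of_natCard_selmerGroup_eq_two W hSel hrk
  have hT2' : ∀ P : W.toAffine.Point, 2 • P = 0 → P = 0 := fun P hP ↦ by convert hT2 P (by convert hP)
  have htor1 : ∀ (M : ℕ) (R : (W.baseChange (ringClassField K ι 1)).toAffine.Point),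
      ((2 ^ M : ℕ) : ℤ) • R = 0 → R = 0 :=
    fun M R hR ↦ eq_zero_of_two_pow_smul_eq_zero_ringClassField_of_noTwoTorsion W hIQ hodd hH hT2' ι M R hR
  have hiv : ∀ x : (W.baseChange K).toAffine.Point, 2 • x = 0 → x = 0 := fun x hx ↦
    forall_two_zsmul_baseChange_eq_zero_of_heegner W K hIQ hodd hH hT2' x (by rw [← natCast_zsmul] at hx; exact_mod_cast hx)
  -- `rank E(K) = rank E(ℚ) + rank T₀(ℚ) = 1 + 0`
  have hSelT : Nat.card ((W.quadraticTwist (NumberField.discr K : ℚ)).selmerGroup ((2 : ℕ) : ℤ)) = 1 := by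
    have h := natCard_selmerGroup_smul (W.quadraticTwist (NumberField.discr K : ℚ)) Cd (n := 2) two_ne_zero
    rw [hWd] at h
    rw [← h, Nat.cast_ofNat]
    exact hSel1
  obtain ⟨hrkT0, -, -⟩ := rank_eq_zero_and_torsionBy_eq_bot_and_sha_inf_torsionBy_eq_bot_of_natCard_selmerGroup_eq_one
    (W.quadraticTwist (NumberField.discr K : ℚ)) 2 hSelT
  haveI : Module.Finite ℤ (W.baseChange K).toAffine.Point := (W.baseChange K).module_finite_point_holds
  have hrkK : (W.baseChange K).mordellWeilRank = 1 := by
    rw [W.mordellWeilRank_baseChange_of_finrank_eq_two_of_finite K h2, hrkW1, hrkT0]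
  -- the exact `2`-divisibility exponent `M` of `P₀` in `E(K)` and `ord₂ [E(K):ℤP₀] = M`
  haveI : Finite (AddCommGroup.torsion (W.baseChange K).toAffine.Point) :=
    WeierstrassCurve.finite_torsion_point (W := W.baseChange K)
  obtain ⟨M, hdivM, hndivM⟩ := exists_pow_smul_eq_and_not_of_not_isOfFinAddOrder Nat.prime_two hPinf
  obtain ⟨cc, Q, hcQ, hcker⟩ := X11b.RankOne.exists_coord_of_mordellWeilRank_eq_one (W.baseChange K) hrkK
  have hidx : padicValNat 2 (AddSubgroup.zmultiples P₀).index = M :=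
    X11b.Three.Koly.padicValNat_index_zmultiples_eq_of_divisibility (p := 2) cc Q hcQ hcker hiv P₀ hdivM hndivM
  have hI0 : (AddSubgroup.zmultiples P₀).index ≠ 0 := fun hI ↦ by
    have hh := P2.torsionOrder_sq_mul_canonicalHeight_eq_index_sq_mul_regulator (W.baseChange K) hrkK P₀ hPinf
    rw [hI, Nat.cast_zero, zero_pow two_ne_zero, zero_mul, mul_eq_zero, pow_eq_zero_iff two_ne_zero,
      Nat.cast_eq_zero] at hh
    exact hh.elim (W.baseChange K).torsionOrder_pos_holds.ne'
      (fun h0 ↦ hPinf ((Affine.Point.canonicalHeight_eq_zero_iff_holds P₀).mp h0))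
  -- `P(1) ∈ 2E(K[1]) ⟺ P₀ ∈ 2E(K)` (no `2`-torsion over `K[1]`)
  have hKK1 : (∃ Q : (W.baseChange (ringClassField K ι 1)).toAffine.Point, (2 : ℤ) • Q = d₁.derivedPoint) ↔
      ∃ Q : (W.baseChange K).toAffine.Point, ((2 ^ 1 : ℕ) : ℤ) • Q = P₀ := by
    rw [← X11b.Three.Koly.pDiv_one_iff_exists_zsmul_eq hIQ d₁ P₀ hP₀K 2 1 (htor1 1)]
    simp [X11b.Three.Koly.PDiv]
  rw [hKK1]
  constructor
  · -- primitive ⟹ `M = 0` ⟹ odd index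
    intro hnot
    have hM0 : M = 0 := by
      by_contra hM
      obtain ⟨R, hR⟩ := hdivM
      apply hnot
      refine ⟨((2 ^ (M - 1) : ℕ) : ℤ) • R, ?_⟩
      rw [smul_smul, ← Nat.cast_mul, pow_one, ← pow_succ', Nat.sub_add_cancel (Nat.one_le_iff_ne_zero.mpr hM), hR]
    rw [hM0] at hidx
    rcases Nat.even_or_odd (AddSubgroup.zmultiples P₀).index with he | ho
    · exfalso
      obtain ⟨k, hk⟩ := he
      have h2dvd : 2 ∣ (AddSubgroup.zmultiples P₀).index := ⟨k, by omega⟩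
      have := (padicValNat.eq_zero_iff.mp hidx)
      rcases this with h | h | h
      · exact absurd h (by norm_num)
      · exact hI0 h
      · exact h h2dvd
    · exact ho
  · -- odd index ⟹ `M = 0` ⟹ primitive
    intro ho hdiv2
    have hM1 : 1 ≤ M := by
      by_contra hM
      have hM0 : M = 0 := by omega
      subst hM0
      exact hndivM hdiv2
    have h2dvd : 2 ∣ (AddSubgroup.zmultiples P₀).index := by
      have h := pow_padicValNat_dvd (p := 2) (n := (AddSubgroup.zmultiples P₀).index)
      rw [hidx] at h
      exact (dvd_pow_self 2 (by omega : M ≠ 0)).trans h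
    exact (Nat.not_even_iff_odd.mpr ho) (even_iff_two_dvd.mpr h2dvd)

end Summit.BirchSwinnertonDyer.BirchSwinnertonDyer.Theorems.GenusExact.TwinSwap

end
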